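/-
Copyright (c) 2026 the pub-hodgecm-mathlib formalisation cell (harness21).  Prover seat hodgecm-mathlib-K2E3-p20 (g3) (line lead (SC-an)), Track B «K2-LIT» ∕ h413,
line `K2_E3_EllipticInputs`, unit U12 «Characters», socket #11, road (11-SC), letter (SC-an) `sig_K2E3SupercuspidalTruncatedCharAnalytic` (U12 ED. 6 :208), brick (D3)
THEOREM 20, sub-brick (T20-d) «TORUS CONTRACTION»: the matrix half of Harish-Chandra's Lemmas 54–55 (LNM 162, pp. 82–83) in the height-ball currency of ★ p856390.
Census `K2/K2E3-p20/g3/CENSUS-Thm20.K2E3-p20-g3.md` e4080422; deal K2E3-plan (g2) 2026-09-04T01:34:25Z (D17).  2026-09-04.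
-/
import Mathlib.Topology.Algebra.Valued.ValuationTopology
import Mathlib.Data.Matrix.Mul
import Mathlib.Data.Fin.VecNotation
import Mathlib.LinearAlgebra.Matrix.Notation
import HarnessLib

/-!
# K2_E3 road (h413 = stmt-HodgeConjecture-24833), unit U12, socket #11, road (11-SC), letter (SC-an), brick (D3) = THEOREM 20 — sub-brick (T20-d) «TORUS CONTRACTION»:
# `(a⁻¹ N a)_{ij} = a_i⁻¹ a_j N_{ij}` for diagonal `a`, the transport of scaled integrality, the contraction of the upper-triangular entries when `|a_j∕a_i| ≤ |ϖ|^k`, and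
# `‖a‖ ≤ ‖N a‖` for unitriangular `N` (Harish-Chandra 1970, Part VII §8, Lemmas 54–55, pp. 82–83)

Cell `pub/hodgecm-mathlib` (D-0151), Track B; `--supports stmt-HodgeConjecture-24833 --as helper`; THEOREMS ONLY — no `def`, no named fact, no instance, no notation, no
`sorry`; Mathlib-only, GENERIC (`K` with `Valued K Γ₀`, any finite index type; §3 at rank one `d = (t, 1, t⁻¹)`).  Currency = the height balls of ★ p856390
`K2E3HeightBallExhaustion` («`g ∈ Ω m ↔ ∀ i j, v(ϖ^m g_{ij}) ≤ 1 ∧ v(ϖ^m (g⁻¹)_{ij}) ≤ 1`»).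

THE MATHEMATICS [HarishChandra1970, p. 82–83]: «Since `A` is diagonal and `N′` triangular, the diagonal of the matrix `a⁻¹n′a − 1` vanishes.  Furthermore
`(a⁻¹n′a)_{ij} = a_i⁻¹ a_j n′_{ij}` (`i ≠ j`)», whence `|a⁻¹n′a − 1| ≤ |n′ − 1| · sup_{α} |ξ_α(a⁻¹)|` (Lemma 55's contraction) and «the diagonal entries of `a` and `n′a` are the
same.  Hence `‖a‖ ≤ ‖n′a‖`» (Lemma 54).  Here:
* §1 `diagonal_inv_mul_mul_diagonal_apply` — the entry formula; `v_pow_mul_conj_apply` — `v(ϖ^m (a⁻¹Na)_{ij}) = v(ϖ^m N_{ij}) · v(d_j ∕ d_i)`;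
  `v_pow_mul_conj_apply_le_one_of_ratio_le_one` — scaled integrality of `N` is KEPT on the entries where `v(d_j∕d_i) ≤ 1`;
  **`v_pow_mul_conj_apply_le_one_of_ratio_le_pow`** — CONTRACTION: if `v(d_j∕d_i) ≤ v(ϖ)^k` and `v(ϖ^{m+k} N_{ij}) ≤ 1` then `v(ϖ^m (a⁻¹Na)_{ij}) ≤ 1` (`k` levels gained).
* §2 `mul_diagonal_apply_self` — `(N a)_{ii} = d_i` for `N` with unit diagonal; **`v_pow_mul_diagonal_le_one_of_mul`** — `‖a‖ ≤ ‖Na‖` in ball form: if `ϖ^m (N a)` is integral then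
  `ϖ^m d_i` is, for every `i`.
* §3 rank one, `d = ![t, 1, t⁻¹]` (the split torus `A` of `U(2,1)` in the antidiagonal model): the three ratios above the diagonal are `t⁻¹, t⁻¹, t⁻²`
  (`ratio_fin_three_01`, `_12`, `_02`), so `|t| ≥ |ϖ|^{−k}` contracts every strictly-upper entry by at least `k` levels (`v_ratio_le_of_le`).

HONEST LABEL: HC_CM is proved only modulo the 7 printed citations (2 remaining named inputs: hLiu418 = stmt-HodgeConjecture-24832, h413 =
stmt-HodgeConjecture-24833) until rung 0 closes; count-neutral `--supports` helper (elementary matrix∕valuation algebra for (T20-e)).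

## References
* [HarishChandra1970] Harish-Chandra (notes by G. van Dijk), *Harmonic Analysis on Reductive p-adic Groups*, LNM 162 (1970), Part VII §8 Lemmas 54–55 pp. 82–83; §2 p. 69.
-/

set_option autoImplicit false
-- the mandated namespace has the single-problem summit's repeated segment (`HodgeConjecture.HodgeConjecture`)
set_option linter.dupNamespace false

noncomputable section

open Matrix

namespace Summit.HodgeConjecture.HodgeConjecture.Cruxes.H413.K2E3TorusContractionRankOne

/-! ## §1 Conjugating by a diagonal matrix: entries, valuations, contraction -/

section Generic

variable {K : Type*} [Field K] {n : Type*} [Fintype n] [DecidableEq n]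

/-- `(diag(d)⁻¹ · N · diag(d))_{ij} = d_i⁻¹ · N_{ij} · d_j` (with `diag(d)⁻¹` spelled `diag(d⁻¹)`).  Print: «`(a⁻¹n′a)_{ij} = a_i⁻¹ a_j n′_{ij}`».
[cite: HarishChandra1970, Part VII §8 p. 82] -/
theorem diagonal_inv_mul_mul_diagonal_apply (d : n → K) (N : Matrix n n K) (i j : n) :
    (diagonal (fun k => (d k)⁻¹) * N * diagonal d) i j = (d i)⁻¹ * N i j * d j := by
  rw [mul_diagonal, Matrix.mul_apply]
  congr 1
  rw [Finset.sum_eq_single i]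
  · rw [diagonal_apply_eq]
  · intro k _ hk
    rw [diagonal_apply_ne _ (Ne.symm hk), zero_mul]
  · intro hi; exact absurd (Finset.mem_univ i) hi

variable {Γ₀ : Type*} [LinearOrderedCommGroupWithZero Γ₀] [Valued K Γ₀]

/-- Scaled valuation of the conjugated entry: `v(ϖ^m (a⁻¹Na)_{ij}) = v(ϖ^m N_{ij}) · v(d_j ∕ d_i)` (no hypothesis: both sides carry `v(d_i⁻¹)`). [cite: HarishChandra1970, Part VII §8 p. 82] -/
theorem v_pow_mul_conj_apply (d : n → K) (N : Matrix n n K) (ϖ : K) (m : ℕ) (i j : n) :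
    Valued.v (ϖ ^ m * (diagonal (fun k => (d k)⁻¹) * N * diagonal d) i j) = Valued.v (ϖ ^ m * N i j) * Valued.v (d j / d i) := by
  rw [diagonal_inv_mul_mul_diagonal_apply, div_eq_mul_inv, map_mul, map_mul, map_mul, map_mul, map_mul]
  ac_rfl

/-- Scaled integrality is KEPT on the entries where the torus does not expand: `v(d_j∕d_i) ≤ 1 ⇒ (v(ϖ^m N_{ij}) ≤ 1 ⇒ v(ϖ^m (a⁻¹Na)_{ij}) ≤ 1)`.
[cite: HarishChandra1970, Part VII §8 p. 82–83] -/
theorem v_pow_mul_conj_apply_le_one_of_ratio_le_one {d : n → K} {N : Matrix n n K} {ϖ : K} {m : ℕ} {i j : n}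
    (hN : Valued.v (ϖ ^ m * N i j) ≤ 1) (hr : Valued.v (d j / d i) ≤ 1) :
    Valued.v (ϖ ^ m * (diagonal (fun k => (d k)⁻¹) * N * diagonal d) i j) ≤ 1 := by
  rw [v_pow_mul_conj_apply]
  exact mul_le_one' hN hr

/-- **CONTRACTION** (Lemma 55's «`|a⁻¹n′a − 1| ≤ |n′ − 1| sup_α |ξ_α(a⁻¹)|`», entrywise): if the torus contracts the `(i,j)` entry by `k` levels, `v(d_j∕d_i) ≤ v(ϖ)^k`, then an
entry of level `−(m+k)` becomes one of level `−m`: `v(ϖ^{m+k} N_{ij}) ≤ 1 ⇒ v(ϖ^m (a⁻¹Na)_{ij}) ≤ 1`. [cite: HarishChandra1970, Part VII §8 Lemma 55 p. 83] -/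
theorem v_pow_mul_conj_apply_le_one_of_ratio_le_pow {d : n → K} {N : Matrix n n K} {ϖ : K} {m k : ℕ} {i j : n}
    (hN : Valued.v (ϖ ^ (m + k) * N i j) ≤ 1) (hr : Valued.v (d j / d i) ≤ Valued.v ϖ ^ k) :
    Valued.v (ϖ ^ m * (diagonal (fun k => (d k)⁻¹) * N * diagonal d) i j) ≤ 1 := by
  rw [v_pow_mul_conj_apply]
  calc Valued.v (ϖ ^ m * N i j) * Valued.v (d j / d i) ≤ Valued.v (ϖ ^ m * N i j) * Valued.v ϖ ^ k :=
        mul_le_mul' le_rfl hr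
    _ = Valued.v (ϖ ^ (m + k) * N i j) := by rw [map_mul, map_mul, map_pow, map_pow, pow_add]; ac_rfl
    _ ≤ 1 := hN

/-! ## §2 `‖a‖ ≤ ‖N a‖` for unitriangular `N` -/

omit [DecidableEq n] in
/-- `(N · diag(d))_{ii} = d_i` when `N_{ii} = 1` (the diagonal of `n′a` is that of `a`). [cite: HarishChandra1970, Part VII §8 Lemma 54 p. 82] -/
theorem mul_diagonal_apply_self [DecidableEq n] {N : Matrix n n K} (hN : ∀ i, N i i = 1) (d : n → K) (i : n) :
    (N * diagonal d) i i = d i := by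
  rw [mul_diagonal, hN, one_mul]

/-- **`‖a‖ ≤ ‖N a‖`** in ball form: if `ϖ^m (N a)` is integral (`N` with unit diagonal, `a = diag(d)`) then `ϖ^m d_i` is integral for every `i` — Lemma 54's «the diagonal entries of
`a` and `n′a` are the same. Hence `‖a‖ ≤ ‖n′a‖`». [cite: HarishChandra1970, Part VII §8 Lemma 54 p. 82] -/
theorem v_pow_mul_diagonal_le_one_of_mul {N : Matrix n n K} (hN : ∀ i, N i i = 1) {d : n → K} {ϖ : K} {m : ℕ}
    (h : ∀ i j, Valued.v (ϖ ^ m * (N * diagonal d) i j) ≤ 1) (i : n) : Valued.v (ϖ ^ m * d i) ≤ 1 := by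
  have := h i i
  rwa [mul_diagonal_apply_self hN] at this

/-- The same for `a N` (left translate): `(diag(d) · N)_{ii} = d_i`. [cite: HarishChandra1970, Part VII §8 Lemma 54 p. 82] -/
theorem v_pow_diagonal_mul_le_one_of_mul {N : Matrix n n K} (hN : ∀ i, N i i = 1) {d : n → K} {ϖ : K} {m : ℕ}
    (h : ∀ i j, Valued.v (ϖ ^ m * (diagonal d * N) i j) ≤ 1) (i : n) : Valued.v (ϖ ^ m * d i) ≤ 1 := by
  have := h i i
  rwa [diagonal_mul, hN, mul_one] at this

end Generic

/-! ## §3 Rank one: the split torus `a = diag(t, 1, t⁻¹)` of `U(2,1)` -/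

section RankOne

variable {K : Type*} [Field K] {Γ₀ : Type*} [LinearOrderedCommGroupWithZero Γ₀] [Valued K Γ₀]

/-- The three entries of `d = (t, 1, t⁻¹)` are non-zero for `t ≠ 0`. [cite: HarishChandra1970, Part VII §8 p. 82] -/
theorem vecThree_ne_zero {t : K} (ht : t ≠ 0) : ∀ k : Fin 3, (![t, 1, t⁻¹] : Fin 3 → K) k ≠ 0 := by
  intro k
  fin_cases k
  · exact ht
  · exact one_ne_zero
  · exact inv_ne_zero ht

/-- Ratio above the diagonal, entry `(0,1)`: `d₁∕d₀ = t⁻¹`. [cite: HarishChandra1970, Part VII §8 p. 82] -/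
theorem ratio_fin_three_01 (t : K) : (![t, 1, t⁻¹] : Fin 3 → K) 1 / (![t, 1, t⁻¹] : Fin 3 → K) 0 = t⁻¹ := by
  simp [div_eq_mul_inv]

/-- Ratio above the diagonal, entry `(1,2)`: `d₂∕d₁ = t⁻¹`. [cite: HarishChandra1970, Part VII §8 p. 82] -/
theorem ratio_fin_three_12 (t : K) : (![t, 1, t⁻¹] : Fin 3 → K) 2 / (![t, 1, t⁻¹] : Fin 3 → K) 1 = t⁻¹ := by
  simp

/-- Ratio above the diagonal, entry `(0,2)`: `d₂∕d₀ = t⁻¹ · t⁻¹`. [cite: HarishChandra1970, Part VII §8 p. 82] -/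
theorem ratio_fin_three_02 (t : K) : (![t, 1, t⁻¹] : Fin 3 → K) 2 / (![t, 1, t⁻¹] : Fin 3 → K) 0 = t⁻¹ * t⁻¹ := by
  simp [div_eq_mul_inv]

/-- **The contraction factor at rank one**: if `|t| ≥ |ϖ|^{−k}` (i.e. `v(t⁻¹) ≤ v(ϖ)^k`, `a` deep in `A⁺(B)`) then every ratio above the diagonal is `≤ v(ϖ)^k`:
`v(t⁻¹) ≤ v(ϖ)^k` and `v(t⁻¹·t⁻¹) ≤ v(ϖ)^k` (`|ϖ| ≤ 1`). [cite: HarishChandra1970, Part VII §8 Lemma 55 p. 83] -/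
theorem v_ratio_le_of_le {t ϖ : K} {k : ℕ} (hϖ : Valued.v ϖ ≤ 1) (ht : Valued.v t⁻¹ ≤ Valued.v ϖ ^ k) :
    Valued.v t⁻¹ ≤ Valued.v ϖ ^ k ∧ Valued.v (t⁻¹ * t⁻¹) ≤ Valued.v ϖ ^ k := by
  refine ⟨ht, ?_⟩
  rw [map_mul]
  have h1 : Valued.v t⁻¹ ≤ 1 := ht.trans (pow_le_one' hϖ k)
  calc Valued.v t⁻¹ * Valued.v t⁻¹ ≤ Valued.v t⁻¹ * 1 := mul_le_mul' le_rfl h1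
    _ = Valued.v t⁻¹ := mul_one _
    _ ≤ Valued.v ϖ ^ k := ht

end RankOne

end Summit.HodgeConjecture.HodgeConjecture.Cruxes.H413.K2E3TorusContractionRankOne

end
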